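import Literature.MathematicalPhysics.QuantumFieldTheory.QCDTransferMatrix

/-!
# Explicit inverse of the chain block `E = A P⁻ − P⁺ W′` of the Wilson slice reduction
(helper for crux stmt-QuantumFields-9737 `QuarksAsStableAction.StableActionBridge`, line `Sketch` —
stub `projChainBlock_mul_explicitInv`)

In the time-slice reduction of the `r = 1` Wilson fermion determinant
`det D_W[U] = ∏ₜ det Eₜ · det (1 − (−1)ᴸ ∏ₜ Eₜ⁻¹ Fₜ)` the chain blocks are
`Eₜ = Aₜ P⁻ − P⁺ W′ₜ₋₁`, `Fₜ = Aₜ P⁺ − P⁻ Wₜ`, where `P± = ½ (1 ± γ₄)` are complementary projections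
(`P⁺ + P⁻ = 1`, `P±² = P±`, `P⁺P⁻ = P⁻P⁺ = 0`), `A = Bh + C` with a spin-blind invertible part `Bh`
commuting with `P±` and an off-diagonal part `C` with `P⁻ C P⁻ = 0`, and `W`, `W′` the temporal
transporters (`W′ W = 1`, `W′` commuting with `P⁺`, `W` with `P⁻`).  In the `(V⁺, V⁻)` block
decomposition `E = [[−W′, C], [0, Bh]]`, so `E` has the explicit right inverse
`Ẽ = [[−W, W C Bh⁻¹], [0, Bh⁻¹]] = −W P⁺ + W P⁺ C Bh⁻¹ P⁻ + Bh⁻¹ P⁻`; this file proves `E Ẽ = 1`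
(the registered stub `projChainBlock_mul_explicitInv`), which the lead uses to bring `∏ E⁻¹ F`
into Lüscher's transfer-matrix form.

The computation is a noncommutative-ring identity (sub-namespace `ChainBlockInverse`,
`chainBlock_mul_explicitInv_of_ring`, stated with an abstract two-sided inverse `Bi` of `Bh`):
column by column,
* `E (W P⁺) = (Bh + C)(P⁻ W P⁺) − P⁺ (W′ W) P⁺ = 0 − P⁺`       (`P⁻ W = W P⁻`, `P⁻ P⁺ = 0`),
* `E (W P⁺ C Bi P⁻) = (E W P⁺) C Bi P⁻ = −P⁺ C Bi P⁻`,
* `E (Bi P⁻) = (Bh + C) Bi P⁻ P⁻ − W′ (P⁺ P⁻) Bi = P⁻ + C Bi P⁻`   (`Bi P⁻ = P⁻ Bi`),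
and the sum is `P⁺ + P⁻ + (1 − P⁺) C Bi P⁻ = 1 + (P⁻ C P⁻) Bi = 1`.  The matrix statement follows
with `Bi = Bh⁻¹` (`Matrix.mul_nonsing_inv`, `Matrix.nonsing_inv_mul`), the commutation of `Bh⁻¹`
with `P⁻` being inherited from that of `Bh`.  Pure theorem file (no definitions), Mathlib only.
-/

namespace Summit.QuantumFields.QCD.Cruxes.StableActionBridge.Sketch

open scoped ComplexOrder
open Literature.MathematicalPhysics.QuantumFieldTheory Literature.MathematicalPhysics.QuantumLattice

namespace ChainBlockInverse

/-- A two-sided inverse inherits commutation: if `B Bi = 1 = Bi B` and `B P = P B`, then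
`Bi P = P Bi`. -/
theorem inv_comm_of_comm {R : Type*} [Ring R] (B Bi P : R) (h1 : B * Bi = 1) (h2 : Bi * B = 1)
    (h : B * P = P * B) : Bi * P = P * Bi :=
  calc Bi * P = Bi * P * (B * Bi) := by rw [h1, mul_one]
    _ = Bi * (B * P) * Bi := by rw [h]; simp only [mul_assoc]
    _ = P * Bi := by rw [← mul_assoc, h2, one_mul]

/-- **The chain-block inverse as a ring identity.**  For complementary idempotents `Pp + Pm = 1`
(`Pp Pm = Pm Pp = 0`), `Bh Bi = 1` with `Bi` commuting with `Pm`, `Pm C Pm = 0`, `W′ Pp = Pp W′`,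
`W Pm = Pm W` and `W′ W = 1`:
`((Bh + C) Pm − Pp W′) · (−W Pp + W Pp C Bi Pm + Bi Pm) = 1`. -/
theorem chainBlock_mul_explicitInv_of_ring {R : Type*} [Ring R] (Pp Pm Bh Bi C W W' : R)
    (h1 : Pp + Pm = 1) (hPp : Pp * Pp = Pp) (hPm : Pm * Pm = Pm) (hPpPm : Pp * Pm = 0)
    (hPmPp : Pm * Pp = 0) (hBiPm : Bi * Pm = Pm * Bi) (hC : Pm * C * Pm = 0)
    (hW'Pp : W' * Pp = Pp * W') (hWPm : W * Pm = Pm * W) (hW'W : W' * W = 1)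
    (hBhBi : Bh * Bi = 1) :
    ((Bh + C) * Pm - Pp * W') * (-(W * Pp) + W * Pp * C * Bi * Pm + Bi * Pm) = 1 := by
  -- first column: `E (W Pp) = -Pp`
  have f1 : Pm * (W * Pp) = 0 := by
    rw [← mul_assoc, ← hWPm, mul_assoc, hPmPp, mul_zero]
  have f2 : Pp * W' * (W * Pp) = Pp := by
    rw [mul_assoc, ← mul_assoc W', hW'W, one_mul, hPp]
  have t1 : ((Bh + C) * Pm - Pp * W') * (W * Pp) = -Pp := by
    rw [sub_mul, mul_assoc (Bh + C), f1, mul_zero, f2, zero_sub]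
  -- second column: `E (W Pp C Bi Pm) = -(Pp C Bi Pm)`
  have t2 : ((Bh + C) * Pm - Pp * W') * (W * Pp * C * Bi * Pm) = -(Pp * C * Bi * Pm) := by
    have e : ((Bh + C) * Pm - Pp * W') * (W * Pp * C * Bi * Pm) =
        ((Bh + C) * Pm - Pp * W') * (W * Pp) * C * Bi * Pm := by
      simp only [mul_assoc]
    rw [e, t1, neg_mul, neg_mul, neg_mul]
  -- third column: `E (Bi Pm) = Pm + C Bi Pm`
  have t3a : (Bh + C) * Pm * (Bi * Pm) = Pm + C * Bi * Pm := by
    rw [mul_assoc, ← mul_assoc Pm, ← hBiPm, mul_assoc Bi, hPm, ← mul_assoc, add_mul Bh, hBhBi,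
      add_mul, one_mul]
  have t3b : Pp * W' * (Bi * Pm) = 0 := by
    rw [hBiPm, ← hW'Pp, mul_assoc, ← mul_assoc Pp, hPpPm, zero_mul, mul_zero]
  have t3 : ((Bh + C) * Pm - Pp * W') * (Bi * Pm) = Pm + C * Bi * Pm := by
    rw [sub_mul, t3a, t3b, sub_zero]
  -- the off-diagonal remainder `Pm C Bi Pm = (Pm C Pm) Bi = 0`
  have t4 : Pm * C * Bi * Pm = 0 := by
    rw [mul_assoc, hBiPm, ← mul_assoc, hC, zero_mul]
  have hPp' : Pp = 1 - Pm := eq_sub_of_add_eq h1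
  have t5 : Pp * C * Bi * Pm = C * Bi * Pm := by
    rw [hPp', sub_mul, sub_mul, sub_mul, one_mul, t4, sub_zero]
  rw [mul_add, mul_add, mul_neg, t1, t2, t3, neg_neg, t5]
  calc Pp + -(C * Bi * Pm) + (Pm + C * Bi * Pm) = Pp + Pm := by abel
    _ = 1 := h1

end ChainBlockInverse

/-- **Stub `projChainBlock_mul_explicitInv` of line `Sketch`.**  The chain block
`E = (Bh + C) P⁻ − P⁺ W′` of the Wilson time-slice reduction has the explicit right inverse
`Ẽ = −W P⁺ + W P⁺ C Bh⁻¹ P⁻ + Bh⁻¹ P⁻`: `E Ẽ = 1` (block form `E = [[−W′, C], [0, Bh]]`,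
`Ẽ = [[−W, W C Bh⁻¹], [0, Bh⁻¹]]` in the `(V⁺, V⁻)` decomposition). -/
theorem projChainBlock_mul_explicitInv :
    ∀ (n : Type) [Fintype n] [DecidableEq n] (Pp Pm Bh C W W' : Matrix n n ℂ),
      Pp + Pm = 1 → Pp * Pp = Pp → Pm * Pm = Pm → Pp * Pm = 0 → Pm * Pp = 0 →
      Bh * Pp = Pp * Bh → Bh * Pm = Pm * Bh → Pm * C * Pm = 0 →
      W' * Pp = Pp * W' → W * Pm = Pm * W → W' * W = 1 → IsUnit Bh.det →
      ((Bh + C) * Pm - Pp * W') * (-(W * Pp) + W * Pp * C * Bh⁻¹ * Pm + Bh⁻¹ * Pm) = 1 := by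
  intro n _ _ Pp Pm Bh C W W' h1 hPp hPm hPpPm hPmPp _hBhPp hBhPm hC hW'Pp hWPm hW'W hdet
  have hBi : Bh * Bh⁻¹ = 1 := Matrix.mul_nonsing_inv Bh hdet
  have hiB : Bh⁻¹ * Bh = 1 := Matrix.nonsing_inv_mul Bh hdet
  exact ChainBlockInverse.chainBlock_mul_explicitInv_of_ring Pp Pm Bh Bh⁻¹ C W W' h1 hPp hPm hPpPm
    hPmPp (ChainBlockInverse.inv_comm_of_comm Bh Bh⁻¹ Pm hBi hiB hBhPm) hC hW'Pp hWPm hW'W hBi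

end Summit.QuantumFields.QCD.Cruxes.StableActionBridge.Sketch
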